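import Literature.Analysis.FluidPDE.BoltzmannEquation
import Literature.Analysis.FluidPDE.HardSpherePhaseSpaceProofs

/-!
# Proofs for `Literature.Analysis.FluidPDE.BoltzmannEquation`
(trunk: FluidKinetic / T-KINETIC, item K4; companion ("Proofs") file discharging named facts of
`Literature.Analysis.FluidPDE.BoltzmannEquation`. This file is SHARED by several discharges:
extend it by appending a new section to the current tree version — never replace it wholesale.)

Contents:

1. `Literature.Analysis.FluidPDE.IsMildBoltzmannSolutionOn.totalMass_eq_holds` — conservation of mass for mild
   Boltzmann solutions on the torus (sections `Collide`, `Velocity`, `Torus`).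
2. `Literature.Analysis.FluidPDE.IsClassicalBoltzmannSolutionOn.isRenormalisedSolution_holds` — classical
   solutions of the Boltzmann equation are renormalised solutions in the sense of DiPerna–Lions
   (section `ClassicalIsRenormalisedProof`).

## 1. Conservation of mass for mild Boltzmann solutions on the torus
(discharge of the named fact `Kinetic.IsMildBoltzmannSolutionOn.totalMass_eq`)

Main result: `Kinetic.IsMildBoltzmannSolutionOn.totalMass_eq_holds` — for a Grad cut-off kernel
`B` and a mild solution `f` of the Boltzmann equation on `[0, T] × T^d` in Lanford's class
(`sup e^{β|v|²/2} |f(t)| < ∞` uniformly on `[0, T]`, `f(t)` continuous), the total mass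
`∫_{T^d} ∫_{ℝ^d} f(t, x, v) dv dx` is constant on `[0, T]` (Gallagher–Saint-Raymond–Texier 2013,
Part I Ch. 2, §2.1 eq. (2.1.1) and §2.2: the weak formulation of `Q` and the local conservation
laws obtained from the collision invariant `φ ≡ 1`; Cercignani–Illner–Pulvirenti 1994 §3.1,
(1.5)–(1.13), pp. 33–36). The printed argument is formal ("for `f` regular enough"); the
regularity supplied by the fact (Grad cut-off growth `B ≤ C (1 + |v - v_*|)`, Gaussian weighted
sup bound, continuity) makes every integral absolutely convergent, and the proof is organised as
follows.

* `measurePreserving_collideSwap`: the pre/post-collisional change of variables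
  `(v, v_*) ↦ (v_*', v')` is a linear involution of `E × E`, hence has determinant `±1` and
  preserves Lebesgue measure (the "unit Jacobian" of CIP 1994 §3.1 / GST 2013 §2.2);
  `IsGradCutoffKernel.swap_collide`: a Grad cut-off kernel is invariant under it.
* `integral_collisionOpWith_eq_zero`: consequently `∫ Q_B(g, g) dv = 0` as soon as the gain and
  loss integrands are integrable on `E × E × S^{d-1}` (Fubini + the change of variables);
  `integrable_gain_loss`, `exists_abs_collisionOpWith_le`: Gaussian bounds
  `|g| ≤ M e^{-β|v|²/2}` give this integrability and the uniform estimate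
  `|Q_B(g, g)(v)| ≤ C (1 + |v|) e^{-β|v|²/2}` (conservation of energy makes the Gaussian weight a
  collision invariant, `exp_collide_mul_exp_collide`).
* `measurePreserving_torusShear`: free transport `(x, v) ↦ (x + c(v), v)` preserves `dx dv`
  on `T^d × ℝ^d` (translation invariance of Haar measure on the torus; the general skew-product
  shear lemma `Kinetic.measurePreserving_shear` of
  `Literature.Analysis.FluidPDE.HardSpherePhaseSpaceProofs`).
* `IsMildBoltzmannSolutionOn.measurable_uncurry_clamp`: the fact carries no measurability in
  time, but Duhamel's formula makes `t ↦ f♯(t, x, v)` continuous while `f(t)` is continuous in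
  `(x, v)`, so `f` is jointly measurable on `[0, T] × T^d × ℝ^d` (Carathéodory;
  `stronglyMeasurable_uncurry_of_continuous_of_stronglyMeasurable`).
* `IsMildBoltzmannSolutionOn.totalMass_eq_aux`: integrate Duhamel's formula over `T^d × ℝ^d`,
  undo the free transport by the shear, exchange `∫ dx dv` and `∫₀ᵗ` (Fubini), and use
  `∫∫ Q_B(f(τ, x, ·))(v) dv dx = 0`.

## 2. Classical solutions of the Boltzmann equation are renormalised solutions
(discharge of the named fact `Literature.Analysis.FluidPDE.IsClassicalBoltzmannSolutionOn.isRenormalisedSolution`)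

Main result: `Literature.Analysis.FluidPDE.IsClassicalBoltzmannSolutionOn.isRenormalisedSolution_holds` — a
nonnegative `C¹` solution of `∂ₜ f + v·∇ₓ f = Q_B(f, f)` on `[0, ∞) × E × E` with the
(non-differential) integrability and `L¹`-continuity requirements of the DiPerna–Lions definition
is a renormalised solution with `β(f) = log (1 + f)` (`Literature.Analysis.FluidPDE.IsRenormalisedSolution`):
DiPerna–Lions, Ann. Math. 130 (1989), p. 322, (7)–(8) ("if `f` is a smooth nonnegative solution
of (1) then ... (8) holds"); Cercignani–Illner–Pulvirenti 1994, Lemma 5.3.4 (ii), p. 144. The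
fact is proved exactly as stated (abstract finite-dimensional inner product space `E`, arbitrary
kernel `B`; the collision term enters only through the pointwise Boltzmann equation).

The proof is the chain rule `(∂ₜ + v·∇ₓ) log (1 + f) = Q_B(f, f) / (1 + f)` on `(0, ∞) × E × E`
followed by an integration by parts without boundary terms, organised as follows.

* `Ψ := log (1 + f) φ` is `C¹` with compact support on all of `ℝ × E × E` for a kinetic test
  function `φ` (`Literature.Analysis.FluidPDE.IsKineticTest`: `φ` vanishes near `{t ≤ 0}`, where nothing is
  assumed on `f`).
* Pointwise, the integrand of `IsRenormalisedSolution.identity` equals `∂ₜΨ + v·∇ₓΨ`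
  (product rule, `HasDerivAt.log` / `HasFDerivAt.log`, the Boltzmann equation with
  `derivWithin (Ici 0) = deriv` at interior times, uniqueness of derivatives).
* `∂ₜΨ`, `v·∇ₓΨ` are continuous with compact support, so are all their coordinate slices
  (`hasCompactSupport_comp_section`), and Fubini (`integral_prod`, `integral_integral_swap`)
  reduces the claim to `∫_ℝ ∂ₜΨ(·, x, v) dt = 0` (`integral_eq_zero_of_hasDerivAt_of_integrable`)
  and `∫_E v·∇ₓΨ(t, ·, v) dx = 0` (`integral_mul_fderiv_eq_neg_fderiv_mul_of_integrable` against
  the constant function `1`).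

## References

* I. Gallagher, L. Saint-Raymond, B. Texier, *From Newton to Boltzmann: hard spheres and
  short-range potentials*, Zurich Lectures in Advanced Mathematics, EMS (2013)
  (arXiv:1208.5753), Part I Ch. 2, §2.1 (2.1.1), §2.2 (for 1).
* C. Cercignani, R. Illner, M. Pulvirenti, *The Mathematical Theory of Dilute Gases*, Applied
  Mathematical Sciences 106, Springer (1994), §3.1, (1.5)–(1.13), pp. 33–36 (for 1); §5.3,
  Definition 5.3.3 and Lemma 5.3.4 (ii), p. 144 (for 2).
* R. DiPerna, P.-L. Lions, *On the Cauchy problem for Boltzmann equations: global existence and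
  weak stability*, Ann. Math. 130 (1989) 321–366, p. 322 (7)–(8), Definition p. 326 (for 2).
-/

open MeasureTheory Metric Real Set Filter Topology
open scoped InnerProductSpace ENNReal

namespace Literature.Analysis.FluidPDE

noncomputable section

/-! ## The collision change of variables -/

section Collide

variable {E : Type*} [NormedAddCommGroup E] [InnerProductSpace ℝ E]

/-- Exchanging the two particles commutes with the collision law:
`collide ω (v_*, v) = (v_*', v')`. [folklore] -/
theorem collide_swap (ω : sphere (0 : E) 1) (p : E × E) :
    Literature.MathematicalPhysics.KineticTheory.collide ω p.swap = (Literature.MathematicalPhysics.KineticTheory.collide ω p).swap := by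
  obtain ⟨v, w⟩ := p
  simp only [Literature.MathematicalPhysics.KineticTheory.collide, Prod.swap_prod_mk, Prod.mk.injEq]
  have h : ⟪w - v, (ω : E)⟫_ℝ = -⟪v - w, (ω : E)⟫_ℝ := by
    rw [← inner_neg_left, neg_sub]
  rw [h, neg_smul, sub_neg_eq_add, ← sub_eq_add_neg]
  exact ⟨rfl, rfl⟩

/-- The collision law is jointly continuous in `(p, ω)`. [folklore] -/
@[fun_prop]
theorem continuous_collide_uncurry :
    Continuous (fun q : (E × E) × sphere (0 : E) 1 => Literature.MathematicalPhysics.KineticTheory.collide q.2 q.1) := by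
  unfold Literature.MathematicalPhysics.KineticTheory.collide
  fun_prop

/-- For a fixed impact direction the collision law is continuous. [folklore] -/
@[fun_prop]
theorem continuous_collide (ω : sphere (0 : E) 1) :
    Continuous (fun p : E × E => Literature.MathematicalPhysics.KineticTheory.collide ω p) := by
  unfold Literature.MathematicalPhysics.KineticTheory.collide
  fun_prop

omit [InnerProductSpace ℝ E] in
/-- `1 + |v - w| ≤ (1 + |v|)(1 + |w|)`. [folklore] -/
theorem one_add_norm_sub_le (v w : E) : 1 + ‖v - w‖ ≤ (1 + ‖v‖) * (1 + ‖w‖) := by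
  have h := norm_sub_le v w
  nlinarith [norm_nonneg v, norm_nonneg w]

/-- Gaussian weights are collision invariants (conservation of kinetic energy):
`e^{-β|v'|²/2} e^{-β|v_*'|²/2} = e^{-β|v|²/2} e^{-β|v_*|²/2}`. [folklore] -/
theorem exp_collide_mul_exp_collide (β : ℝ) (ω : sphere (0 : E) 1) (p : E × E) :
    exp (-(β / 2) * ‖(Literature.MathematicalPhysics.KineticTheory.collide ω p).1‖ ^ 2) *
        exp (-(β / 2) * ‖(Literature.MathematicalPhysics.KineticTheory.collide ω p).2‖ ^ 2) =
      exp (-(β / 2) * ‖p.1‖ ^ 2) * exp (-(β / 2) * ‖p.2‖ ^ 2) := by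
  rw [← Real.exp_add, ← Real.exp_add, ← mul_add, ← mul_add,
    Literature.MathematicalPhysics.KineticTheory.norm_sq_collide_fst_add_norm_sq_collide_snd]

/-- The swapped collision map is an involution (GST 2013 §2.1). [folklore] -/
theorem collideSwap_collideSwap (ω : sphere (0 : E) 1) (p : E × E) :
    (Literature.MathematicalPhysics.KineticTheory.collide ω (Literature.MathematicalPhysics.KineticTheory.collide ω p).swap).swap = p := by
  rw [← collide_swap, Prod.swap_swap, Literature.MathematicalPhysics.KineticTheory.collide_collide]

/-- The swapped collision map `(v, v_*) ↦ (v_*', v')` is a linear endomorphism of `E × E`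
(packaged existentially, so that this file only declares theorems). [folklore] -/
theorem exists_linearMap_collideSwap (ω : sphere (0 : E) 1) :
    ∃ L : E × E →ₗ[ℝ] E × E, ∀ p, L p = (Literature.MathematicalPhysics.KineticTheory.collide ω p).swap := by
  refine ⟨{ toFun := fun p => (Literature.MathematicalPhysics.KineticTheory.collide ω p).swap
            map_add' := fun p q => ?_
            map_smul' := fun c p => ?_ }, fun p => rfl⟩
  · obtain ⟨v, w⟩ := p
    obtain ⟨v', w'⟩ := q
    simp only [Literature.MathematicalPhysics.KineticTheory.collide, Prod.swap_prod_mk, Prod.mk_add_mk, Prod.mk.injEq]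
    constructor
    · rw [show v + v' - (w + w') = (v - w) + (v' - w') by abel, inner_add_left, add_smul]
      abel
    · rw [show v + v' - (w + w') = (v - w) + (v' - w') by abel, inner_add_left, add_smul]
      abel
  · obtain ⟨v, w⟩ := p
    simp only [Literature.MathematicalPhysics.KineticTheory.collide, Prod.swap_prod_mk, Prod.smul_mk, RingHom.id_apply, Prod.mk.injEq]
    constructor
    · rw [← smul_sub, inner_smul_left, RCLike.conj_to_real, mul_smul, smul_add]
    · rw [← smul_sub, inner_smul_left, RCLike.conj_to_real, mul_smul, smul_sub]

/-- A linear realisation of the swapped collision map has determinant `±1` (it is an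
involution). [folklore] -/
theorem abs_det_eq_one_of_collideSwap (ω : sphere (0 : E) 1) {L : E × E →ₗ[ℝ] E × E}
    (hL : ∀ p, L p = (Literature.MathematicalPhysics.KineticTheory.collide ω p).swap) : |LinearMap.det L| = 1 := by
  have hLL : L.comp L = LinearMap.id := LinearMap.ext fun p => by
    simp only [LinearMap.coe_comp, Function.comp_apply, hL, LinearMap.id_coe, id_eq,
      collideSwap_collideSwap]
  have h := congrArg LinearMap.det hLL
  rw [LinearMap.det_comp, LinearMap.det_id] at h
  have h2 : |LinearMap.det L| ^ 2 = 1 := by rw [sq_abs, sq, h]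
  nlinarith [h2, abs_nonneg (LinearMap.det L)]

variable [FiniteDimensional ℝ E] [MeasurableSpace E] [BorelSpace E]

/-- The swapped collision map is a measurable involution of `E × E` (packaged existentially as a
`MeasurableEquiv`). [folklore] -/
theorem exists_measurableEquiv_collideSwap (ω : sphere (0 : E) 1) :
    ∃ e : E × E ≃ᵐ E × E, ∀ p, e p = (Literature.MathematicalPhysics.KineticTheory.collide ω p).swap :=
  ⟨{ toFun := fun p => (Literature.MathematicalPhysics.KineticTheory.collide ω p).swap
     invFun := fun p => (Literature.MathematicalPhysics.KineticTheory.collide ω p).swap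
     left_inv := fun p => collideSwap_collideSwap ω p
     right_inv := fun p => collideSwap_collideSwap ω p
     measurable_toFun :=
       ((continuous_collide ω).snd.prodMk (continuous_collide ω).fst).measurable
     measurable_invFun :=
       ((continuous_collide ω).snd.prodMk (continuous_collide ω).fst).measurable },
    fun _ => rfl⟩

/-- **Unit Jacobian of the collision change of variables** (CIP 1994 §3.1, p. 35; GST 2013 §2.2):
`(v, v_*) ↦ (v_*', v')` preserves Lebesgue measure on `E × E`, being a linear involution
(`|det| = 1`, `Measure.map_linearMap_addHaar_eq_smul_addHaar`). [cite: CIP1994, §3.1 p. 35] -/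
theorem measurePreserving_collideSwap (ω : sphere (0 : E) 1) :
    MeasurePreserving (fun p : E × E => (Literature.MathematicalPhysics.KineticTheory.collide ω p).swap)
      ((volume : Measure E).prod volume) ((volume : Measure E).prod volume) := by
  obtain ⟨L, hL⟩ := exists_linearMap_collideSwap ω
  have habs := abs_det_eq_one_of_collideSwap ω hL
  have hdet : LinearMap.det L ≠ 0 := by
    intro h
    rw [h, abs_zero] at habs
    exact zero_ne_one habs
  have hfun : (fun p : E × E => (Literature.MathematicalPhysics.KineticTheory.collide ω p).swap) = L := funext fun p => (hL p).symm
  rw [hfun]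
  refine ⟨L.continuous_of_finiteDimensional.measurable, ?_⟩
  have h := Measure.map_linearMap_addHaar_eq_smul_addHaar ((volume : Measure E).prod volume) hdet
  rw [abs_inv, habs, inv_one, ENNReal.ofReal_one, one_smul] at h
  exact h

/-- Change of variables `(v, v_*) ↦ (v_*', v')` in integrals over `E × E`
(CIP 1994 §3.1, (1.7)–(1.9)). [cite: CIP1994, §3.1 (1.7)–(1.9)] -/
theorem integral_comp_collideSwap (ω : sphere (0 : E) 1) (F : E × E → ℝ) :
    ∫ p, F (Literature.MathematicalPhysics.KineticTheory.collide ω p).swap ∂((volume : Measure E).prod volume) =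
      ∫ p, F p ∂((volume : Measure E).prod volume) := by
  obtain ⟨e, he⟩ := exists_measurableEquiv_collideSwap ω
  have hfun : (fun p : E × E => (Literature.MathematicalPhysics.KineticTheory.collide ω p).swap) = e := funext fun p => (he p).symm
  have hpres : MeasurePreserving e ((volume : Measure E).prod volume)
      ((volume : Measure E).prod volume) := by
    rw [← hfun]
    exact measurePreserving_collideSwap ω
  have h := hpres.integral_comp' F
  simpa only [he] using h

end Collide

/-! ## Integrability of the collision integrands and `∫ Q_B(g, g) dv = 0` -/

section Velocity

variable {E : Type*} [NormedAddCommGroup E] [InnerProductSpace ℝ E] [MeasurableSpace E]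
  {B : E × E → sphere (0 : E) 1 → ℝ}

/-- Symmetry of a Grad cut-off kernel under the swapped collision map:
`B(v_*', v', ω) = B(v, v_*, ω)` (from micro-reversibility and exchange symmetry). [folklore] -/
theorem IsGradCutoffKernel.swap_collide (hB : IsGradCutoffKernel B) (p : E × E)
    (ω : sphere (0 : E) 1) : B (Literature.MathematicalPhysics.KineticTheory.collide ω p).swap ω = B p ω := by
  have h1 := hB.swap_neg (Literature.MathematicalPhysics.KineticTheory.collide ω p).swap ω
  rw [Prod.swap_swap, hB.collide_neg] at h1
  exact h1.symm

/-- A Grad cut-off kernel admits a nonnegative growth constant. [folklore] -/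
theorem IsGradCutoffKernel.exists_bound_nonneg (hB : IsGradCutoffKernel B) :
    ∃ K : ℝ, 0 ≤ K ∧ ∀ p ω, B p ω ≤ K * (1 + ‖p.1 - p.2‖) := by
  obtain ⟨K, hK⟩ := hB.exists_bound
  refine ⟨max K 0, le_max_right _ _, fun p ω => (hK p ω).trans ?_⟩
  exact mul_le_mul_of_nonneg_right (le_max_left _ _) (by positivity)

/-- The elementary bound behind all integrability statements: for a Grad cut-off kernel with
growth constant `K ≥ 0` and `|g| ≤ M e^{-β|v|²/2}`, both the gain and the loss integrand of
`Q_B(g, g)` are bounded by `K M² ψ(v) ψ(v_*)` with `ψ(u) = (1 + |u|) e^{-β|u|²/2}`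
(conservation of energy turns the Gaussian weight into a collision invariant, the mechanism of
the continuity estimates of GST 2013, Part II Ch. 5). [folklore] -/
theorem abs_gain_le_and_abs_loss_le (hB : IsGradCutoffKernel B) {K : ℝ} (hK0 : 0 ≤ K)
    (hK : ∀ p ω, B p ω ≤ K * (1 + ‖p.1 - p.2‖)) {M β : ℝ} {g : E → ℝ}
    (hg : ∀ v, |g v| ≤ M * exp (-(β / 2) * ‖v‖ ^ 2)) (p : E × E) (ω : sphere (0 : E) 1) :
    |B p ω * (g (Literature.MathematicalPhysics.KineticTheory.collide ω p).1 * g (Literature.MathematicalPhysics.KineticTheory.collide ω p).2)| ≤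
        K * M ^ 2 * (((1 + ‖p.1‖) * exp (-(β / 2) * ‖p.1‖ ^ 2)) *
          ((1 + ‖p.2‖) * exp (-(β / 2) * ‖p.2‖ ^ 2))) ∧
      |B p ω * (g p.1 * g p.2)| ≤
        K * M ^ 2 * (((1 + ‖p.1‖) * exp (-(β / 2) * ‖p.1‖ ^ 2)) *
          ((1 + ‖p.2‖) * exp (-(β / 2) * ‖p.2‖ ^ 2))) := by
  have hBle : |B p ω| ≤ K * ((1 + ‖p.1‖) * (1 + ‖p.2‖)) := by
    rw [abs_of_nonneg (hB.nonneg p ω)]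
    exact (hK p ω).trans (mul_le_mul_of_nonneg_left (one_add_norm_sub_le _ _) hK0)
  have key : ∀ a b : E, |g a * g b| ≤
      M ^ 2 * (exp (-(β / 2) * ‖a‖ ^ 2) * exp (-(β / 2) * ‖b‖ ^ 2)) := by
    intro a b
    rw [abs_mul]
    calc |g a| * |g b| ≤ (M * exp (-(β / 2) * ‖a‖ ^ 2)) * (M * exp (-(β / 2) * ‖b‖ ^ 2)) :=
          mul_le_mul (hg a) (hg b) (abs_nonneg _) ((abs_nonneg _).trans (hg a))
      _ = _ := by ring
  constructor
  · rw [abs_mul]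
    calc |B p ω| * |g (Literature.MathematicalPhysics.KineticTheory.collide ω p).1 * g (Literature.MathematicalPhysics.KineticTheory.collide ω p).2|
        ≤ (K * ((1 + ‖p.1‖) * (1 + ‖p.2‖))) *
          (M ^ 2 * (exp (-(β / 2) * ‖(Literature.MathematicalPhysics.KineticTheory.collide ω p).1‖ ^ 2) *
            exp (-(β / 2) * ‖(Literature.MathematicalPhysics.KineticTheory.collide ω p).2‖ ^ 2))) :=
          mul_le_mul hBle (key _ _) (abs_nonneg _) (by positivity)
      _ = _ := by rw [exp_collide_mul_exp_collide]; ring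
  · rw [abs_mul]
    calc |B p ω| * |g p.1 * g p.2|
        ≤ (K * ((1 + ‖p.1‖) * (1 + ‖p.2‖))) *
          (M ^ 2 * (exp (-(β / 2) * ‖p.1‖ ^ 2) * exp (-(β / 2) * ‖p.2‖ ^ 2))) :=
          mul_le_mul hBle (key _ _) (abs_nonneg _) (by positivity)
      _ = _ := by ring

variable [BorelSpace E] [FiniteDimensional ℝ E]

/-- The gain integrand `B(v, v_*, ω) g(v') h(v_*')` is jointly measurable. [folklore] -/
theorem measurable_gainIntegrand (hBm : Measurable (Function.uncurry B)) {g h : E → ℝ}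
    (hg : Measurable g) (hh : Measurable h) :
    Measurable (fun q : (E × E) × sphere (0 : E) 1 =>
      B q.1 q.2 * (g (Literature.MathematicalPhysics.KineticTheory.collide q.2 q.1).1 * h (Literature.MathematicalPhysics.KineticTheory.collide q.2 q.1).2)) :=
  hBm.mul ((hg.comp continuous_collide_uncurry.fst.measurable).mul
    (hh.comp continuous_collide_uncurry.snd.measurable))

omit [InnerProductSpace ℝ E] [BorelSpace E] [FiniteDimensional ℝ E] in
/-- The loss integrand `B(v, v_*, ω) g(v) h(v_*)` is jointly measurable. [folklore] -/
theorem measurable_lossIntegrand (hBm : Measurable (Function.uncurry B)) {g h : E → ℝ}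
    (hg : Measurable g) (hh : Measurable h) :
    Measurable (fun q : (E × E) × sphere (0 : E) 1 => B q.1 q.2 * (g q.1.1 * h q.1.2)) :=
  hBm.mul ((hg.comp measurable_fst.fst).mul (hh.comp measurable_fst.snd))

/-- The sphere measure `Hilbert6.sphereMeasure = volume.toSphere` is finite (a theorem, used via
`haveI`; this file declares no instances). [folklore] -/
theorem isFiniteMeasure_sphereMeasure :
    IsFiniteMeasure (Literature.MathematicalPhysics.KineticTheory.sphereMeasure : Measure (sphere (0 : E) 1)) := by
  unfold Literature.MathematicalPhysics.KineticTheory.sphereMeasure; infer_instance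

/-- The collision term with measurably varying density and velocity is measurable in the
parameter (Fubini measurability of parametric integrals, twice). [folklore] -/
theorem measurable_collisionOpWith_param {α : Type*} [MeasurableSpace α]
    (hBm : Measurable (Function.uncurry B)) {g : α → E → ℝ} (hg : Measurable (Function.uncurry g))
    {u : α → E} (hu : Measurable u) :
    Measurable fun a => collisionOpWith B (g a) (g a) (u a) := by
  haveI := isFiniteMeasure_sphereMeasure (E := E)
  have hr : Measurable fun q : (α × E) × sphere (0 : E) 1 => ((u q.1.1, q.1.2), q.2) :=
    ((hu.comp measurable_fst.fst).prodMk measurable_fst.snd).prodMk measurable_snd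
  have ha : Measurable fun q : (α × E) × sphere (0 : E) 1 => q.1.1 := measurable_fst.fst
  have hc1 : Measurable fun q : (α × E) × sphere (0 : E) 1 =>
      (Literature.MathematicalPhysics.KineticTheory.collide q.2 (u q.1.1, q.1.2)).1 :=
    continuous_collide_uncurry.fst.measurable.comp hr
  have hc2 : Measurable fun q : (α × E) × sphere (0 : E) 1 =>
      (Literature.MathematicalPhysics.KineticTheory.collide q.2 (u q.1.1, q.1.2)).2 :=
    continuous_collide_uncurry.snd.measurable.comp hr
  have hk : Measurable fun q : (α × E) × sphere (0 : E) 1 =>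
      B (u q.1.1, q.1.2) q.2 * (g q.1.1 (Literature.MathematicalPhysics.KineticTheory.collide q.2 (u q.1.1, q.1.2)).1 *
        g q.1.1 (Literature.MathematicalPhysics.KineticTheory.collide q.2 (u q.1.1, q.1.2)).2 - g q.1.1 (u q.1.1) * g q.1.1 q.1.2) :=
    (hBm.comp hr).mul (((hg.comp (ha.prodMk hc1)).mul (hg.comp (ha.prodMk hc2))).sub
      ((hg.comp (ha.prodMk (hu.comp ha))).mul (hg.comp (ha.prodMk measurable_fst.snd))))
  have h1 := hk.stronglyMeasurable.integral_prod_right'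
    (ν := (Literature.MathematicalPhysics.KineticTheory.sphereMeasure : Measure (sphere (0 : E) 1)))
  have h2 := h1.integral_prod_right' (ν := (volume : Measure E))
  exact h2.measurable

/-- Real Gaussians `e^{-b|v|²}`, `b > 0`, are integrable on a finite-dimensional inner product
space (norm of Mathlib's `GaussianFourier.integrable_cexp_neg_mul_sq_norm_add`). [folklore] -/
theorem integrable_exp_neg_mul_sq_norm {b : ℝ} (hb : 0 < b) :
    Integrable (fun v : E => exp (-b * ‖v‖ ^ 2)) := by
  have h := (GaussianFourier.integrable_cexp_neg_mul_sq_norm_add (V := E) (b := b)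
    (by simpa using hb) 0 0).norm
  refine h.congr (Eventually.of_forall fun v => ?_)
  simp only [zero_mul, add_zero, Complex.norm_exp]
  congr 1
  have : -(b : ℂ) * (‖v‖ : ℂ) ^ 2 = ((-b * ‖v‖ ^ 2 : ℝ) : ℂ) := by push_cast; ring
  rw [this, Complex.ofReal_re]

/-- `ψ(v) = (1 + |v|) e^{-β|v|²/2}` is integrable for `β > 0`
(`(1 + s) ≤ (1 + 4/β) e^{β s²/4}`). [folklore] -/
theorem integrable_one_add_norm_mul_exp {β : ℝ} (hβ : 0 < β) :
    Integrable (fun v : E => (1 + ‖v‖) * exp (-(β / 2) * ‖v‖ ^ 2)) := by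
  set c := β / 4 with hc_def
  have hc : 0 < c := by positivity
  have hgauss : Integrable (fun v : E => exp (-c * ‖v‖ ^ 2)) := integrable_exp_neg_mul_sq_norm hc
  refine (hgauss.const_mul ((c + 1) / c)).mono' ?_ (Eventually.of_forall fun v => ?_)
  · exact (by fun_prop : Continuous fun v : E =>
      (1 + ‖v‖) * exp (-(β / 2) * ‖v‖ ^ 2)).aestronglyMeasurable
  · rw [Real.norm_of_nonneg (by positivity)]
    have hs := norm_nonneg v
    set s := ‖v‖
    have h1 : (1 + s) * c ≤ (c + 1) * (1 + c * s ^ 2) := by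
      nlinarith [sq_nonneg (c * s - 1), mul_nonneg hc.le (sq_nonneg s)]
    have h2 : 1 + c * s ^ 2 ≤ exp (c * s ^ 2) := by linarith [add_one_le_exp (c * s ^ 2)]
    have h4 : 1 + s ≤ (c + 1) / c * exp (c * s ^ 2) := by
      rw [div_mul_eq_mul_div, le_div_iff₀ hc]
      calc (1 + s) * c ≤ (c + 1) * (1 + c * s ^ 2) := h1
        _ ≤ (c + 1) * exp (c * s ^ 2) := by gcongr
    have h3 : exp (-(β / 2) * s ^ 2) = exp (-c * s ^ 2) / exp (c * s ^ 2) := by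
      rw [← Real.exp_sub]; congr 1; simp only [hc_def]; ring
    rw [h3, mul_div_assoc', div_le_iff₀ (exp_pos _)]
    calc (1 + s) * exp (-c * s ^ 2) ≤ ((c + 1) / c * exp (c * s ^ 2)) * exp (-c * s ^ 2) := by
          gcongr
      _ = (c + 1) / c * exp (-c * s ^ 2) * exp (c * s ^ 2) := by ring

/-- **Absolute convergence of the collision integrals in Lanford's class.** For a Grad cut-off
kernel and a measurable `g` with `|g| ≤ M e^{-β|v|²/2}`, `β > 0`, the gain and loss integrands of
`Q_B(g, g)` are integrable on `E × E × S^{d-1}`. [folklore] -/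
theorem integrable_gain_loss (hB : IsGradCutoffKernel B) {M β : ℝ} (hβ : 0 < β) {g : E → ℝ}
    (hgm : Measurable g) (hg : ∀ v, |g v| ≤ M * exp (-(β / 2) * ‖v‖ ^ 2)) :
    Integrable (fun q : (E × E) × sphere (0 : E) 1 =>
        B q.1 q.2 * (g (Literature.MathematicalPhysics.KineticTheory.collide q.2 q.1).1 * g (Literature.MathematicalPhysics.KineticTheory.collide q.2 q.1).2))
        (((volume : Measure E).prod volume).prod Literature.MathematicalPhysics.KineticTheory.sphereMeasure) ∧
      Integrable (fun q : (E × E) × sphere (0 : E) 1 => B q.1 q.2 * (g q.1.1 * g q.1.2))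
        (((volume : Measure E).prod volume).prod Literature.MathematicalPhysics.KineticTheory.sphereMeasure) := by
  haveI := isFiniteMeasure_sphereMeasure (E := E)
  obtain ⟨K, hK0, hK⟩ := hB.exists_bound_nonneg
  set ψ : E → ℝ := fun u => (1 + ‖u‖) * exp (-(β / 2) * ‖u‖ ^ 2) with hψ_def
  have hψ : Integrable ψ := integrable_one_add_norm_mul_exp hβ
  have hΘ : Integrable (fun q : (E × E) × sphere (0 : E) 1 => K * M ^ 2 * (ψ q.1.1 * ψ q.1.2))
      (((volume : Measure E).prod volume).prod Literature.MathematicalPhysics.KineticTheory.sphereMeasure) :=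
    ((hψ.mul_prod hψ).comp_fst Literature.MathematicalPhysics.KineticTheory.sphereMeasure).const_mul (K * M ^ 2)
  have hb := fun q : (E × E) × sphere (0 : E) 1 =>
    abs_gain_le_and_abs_loss_le hB hK0 hK hg q.1 q.2
  constructor
  · refine hΘ.mono' (measurable_gainIntegrand hB.measurable hgm hgm).aestronglyMeasurable
      (Eventually.of_forall fun q => ?_)
    rw [Real.norm_eq_abs]
    exact (hb q).1
  · refine hΘ.mono' (measurable_lossIntegrand hB.measurable hgm hgm).aestronglyMeasurable
      (Eventually.of_forall fun q => ?_)
    rw [Real.norm_eq_abs]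
    exact (hb q).2

/-- **Lanford-class bound on the collision term**, uniform in the density: for a Grad cut-off
kernel, `β > 0` and `M` there is `C` with `|Q_B(g, g)(v)| ≤ C (1 + |v|) e^{-β|v|²/2}` for
every measurable `g` with `|g| ≤ M e^{-β|v|²/2}` (the crude form, sufficient for mass
conservation, of the weighted `L^∞` continuity estimates for the collision operator of
GST 2013, Part II Ch. 5). [folklore] -/
theorem exists_abs_collisionOpWith_le (hB : IsGradCutoffKernel B) {β : ℝ} (hβ : 0 < β)
    (M : ℝ) :
    ∃ C : ℝ, ∀ g : E → ℝ, Measurable g → (∀ v, |g v| ≤ M * exp (-(β / 2) * ‖v‖ ^ 2)) →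
      ∀ v, |collisionOpWith B g g v| ≤ C * ((1 + ‖v‖) * exp (-(β / 2) * ‖v‖ ^ 2)) := by
  haveI := isFiniteMeasure_sphereMeasure (E := E)
  obtain ⟨K, hK0, hK⟩ := hB.exists_bound_nonneg
  set ψ : E → ℝ := fun u => (1 + ‖u‖) * exp (-(β / 2) * ‖u‖ ^ 2) with hψ_def
  have hψ : Integrable ψ := integrable_one_add_norm_mul_exp hβ
  set S : ℝ := (Literature.MathematicalPhysics.KineticTheory.sphereMeasure : Measure (sphere (0 : E) 1)).real univ with hS_def
  refine ⟨2 * (K * M ^ 2) * S * ∫ w, ψ w, fun g _ hg v => ?_⟩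
  set D : E → sphere (0 : E) 1 → ℝ := fun w ω => B (v, w) ω *
    (g (Literature.MathematicalPhysics.KineticTheory.collide ω (v, w)).1 * g (Literature.MathematicalPhysics.KineticTheory.collide ω (v, w)).2 - g v * g w) with hD_def
  have hD : ∀ w ω, |D w ω| ≤ 2 * (K * M ^ 2) * (ψ v * ψ w) := by
    intro w ω
    have h := abs_gain_le_and_abs_loss_le hB hK0 hK hg (v, w) ω
    rw [hD_def]
    dsimp only
    rw [mul_sub]
    refine (abs_sub _ _).trans ?_
    linarith [h.1, h.2]
  have hinner : ∀ w, ‖∫ ω, D w ω ∂Literature.MathematicalPhysics.KineticTheory.sphereMeasure‖ ≤ 2 * (K * M ^ 2) * (ψ v * ψ w) * S := by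
    intro w
    calc ‖∫ ω, D w ω ∂Literature.MathematicalPhysics.KineticTheory.sphereMeasure‖ ≤ ∫ ω, ‖D w ω‖ ∂Literature.MathematicalPhysics.KineticTheory.sphereMeasure :=
          norm_integral_le_integral_norm _
      _ ≤ ∫ _ω, 2 * (K * M ^ 2) * (ψ v * ψ w) ∂Literature.MathematicalPhysics.KineticTheory.sphereMeasure :=
          integral_mono_of_nonneg (Eventually.of_forall fun _ => norm_nonneg _) (integrable_const _)
            (Eventually.of_forall fun ω => by dsimp only; rw [Real.norm_eq_abs]; exact hD w ω)
      _ = 2 * (K * M ^ 2) * (ψ v * ψ w) * S := by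
          rw [integral_const, smul_eq_mul, hS_def, mul_comm]
  have hI : Integrable (fun w => 2 * (K * M ^ 2) * (ψ v * ψ w) * S) :=
    ((hψ.const_mul (2 * (K * M ^ 2) * ψ v)).mul_const S).congr
      (Eventually.of_forall fun w => by ring)
  calc |collisionOpWith B g g v| = ‖∫ w, ∫ ω, D w ω ∂Literature.MathematicalPhysics.KineticTheory.sphereMeasure‖ := by
        rw [Real.norm_eq_abs]; rfl
    _ ≤ ∫ w, ‖∫ ω, D w ω ∂Literature.MathematicalPhysics.KineticTheory.sphereMeasure‖ := norm_integral_le_integral_norm _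
    _ ≤ ∫ w, 2 * (K * M ^ 2) * (ψ v * ψ w) * S :=
        integral_mono_of_nonneg (Eventually.of_forall fun _ => norm_nonneg _) hI
          (Eventually.of_forall hinner)
    _ = (2 * (K * M ^ 2) * S * ψ v) * ∫ w, ψ w := by
        rw [← integral_const_mul]
        refine integral_congr_ae (Eventually.of_forall fun w => ?_)
        dsimp only
        ring
    _ = (2 * (K * M ^ 2) * S * ∫ w, ψ w) * ψ v := by ring

/-- **`∫ Q_B(g, g) dv = 0` (conservation of mass at the level of the collision operator).**
For a Grad cut-off kernel and integrable gain and loss integrands on `E × E × S^{d-1}`,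
`∫ Q_B(g, g)(v) dv = 0`: Fubini, then the unit-Jacobian change of variables
`(v, v_*) ↦ (v_*', v')` which maps the loss integrand to the gain integrand
(GST 2013 §2.2, `∫ Q(f, f) φ dv = 0` for the collision invariant `φ ≡ 1`; CIP 1994 §3.1
(1.5)–(1.12)). [cite: GST2013, Part I Ch. 2 §2.2] -/
theorem integral_collisionOpWith_eq_zero (hB : IsGradCutoffKernel B) {g : E → ℝ}
    (hG : Integrable (fun q : (E × E) × sphere (0 : E) 1 =>
        B q.1 q.2 * (g (Literature.MathematicalPhysics.KineticTheory.collide q.2 q.1).1 * g (Literature.MathematicalPhysics.KineticTheory.collide q.2 q.1).2))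
        (((volume : Measure E).prod volume).prod Literature.MathematicalPhysics.KineticTheory.sphereMeasure))
    (hL : Integrable (fun q : (E × E) × sphere (0 : E) 1 => B q.1 q.2 * (g q.1.1 * g q.1.2))
        (((volume : Measure E).prod volume).prod Literature.MathematicalPhysics.KineticTheory.sphereMeasure)) :
    ∫ v, collisionOpWith B g g v = 0 := by
  haveI := isFiniteMeasure_sphereMeasure (E := E)
  set G : (E × E) × sphere (0 : E) 1 → ℝ := fun q =>
    B q.1 q.2 * (g (Literature.MathematicalPhysics.KineticTheory.collide q.2 q.1).1 * g (Literature.MathematicalPhysics.KineticTheory.collide q.2 q.1).2) with hG_def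
  set L : (E × E) × sphere (0 : E) 1 → ℝ := fun q => B q.1 q.2 * (g q.1.1 * g q.1.2) with hL_def
  have hD : Integrable (G - L) (((volume : Measure E).prod volume).prod Literature.MathematicalPhysics.KineticTheory.sphereMeasure) :=
    hG.sub hL
  have h1 : (fun v => collisionOpWith B g g v) =
      fun v => ∫ w, ∫ ω, (G - L) ((v, w), ω) ∂Literature.MathematicalPhysics.KineticTheory.sphereMeasure := by
    funext v
    simp only [collisionOpWith, Pi.sub_apply, hG_def, hL_def, mul_sub]
  have h2 : ∫ v, ∫ w, ∫ ω, (G - L) ((v, w), ω) ∂Literature.MathematicalPhysics.KineticTheory.sphereMeasure =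
      ∫ p, ∫ ω, (G - L) (p, ω) ∂Literature.MathematicalPhysics.KineticTheory.sphereMeasure ∂((volume : Measure E).prod volume) :=
    (integral_prod (fun p : E × E => ∫ ω, (G - L) (p, ω) ∂Literature.MathematicalPhysics.KineticTheory.sphereMeasure)
      hD.integral_prod_left).symm
  rw [h1, h2, ← integral_prod _ hD, integral_sub' hG hL, sub_eq_zero, integral_prod_symm _ hG,
    integral_prod_symm _ hL]
  refine integral_congr_ae (Eventually.of_forall fun ω => ?_)
  dsimp only
  rw [← integral_comp_collideSwap ω (fun p => L (p, ω))]
  refine integral_congr_ae (Eventually.of_forall fun p => ?_)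
  simp only [hG_def, hL_def, Prod.fst_swap, Prod.snd_swap, hB.swap_collide,
    mul_comm (g (Literature.MathematicalPhysics.KineticTheory.collide ω p).2)]

end Velocity

/-! ## The torus: free transport, joint measurability, conservation of mass -/

section Torus

variable {d : Type*} [Fintype d]

omit [Fintype d] in
/-- The shear `(x, v) ↦ (x + c(v), v)` of `T^d × ℝ^d` is a measurable equivalence (packaged
existentially, so that this file only declares theorems). [folklore] -/
theorem exists_measurableEquiv_shear {c : EuclideanSpace ℝ d → UnitAddTorus d} (hc : Measurable c) :
    ∃ e : UnitAddTorus d × EuclideanSpace ℝ d ≃ᵐ UnitAddTorus d × EuclideanSpace ℝ d,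
      ∀ z, e z = (z.1 + c z.2, z.2) :=
  ⟨{ toFun := fun z => (z.1 + c z.2, z.2)
     invFun := fun z => (z.1 - c z.2, z.2)
     left_inv := fun z => by simp
     right_inv := fun z => by simp
     measurable_toFun := (measurable_fst.add (hc.comp measurable_snd)).prodMk measurable_snd
     measurable_invFun := (measurable_fst.sub (hc.comp measurable_snd)).prodMk measurable_snd },
    fun _ => rfl⟩

/-- **Free transport preserves `dx dv` on `T^d × ℝ^d`**: the shear `(x, v) ↦ (x + c(v), v)` is
measure preserving (translation invariance of Haar measure on the torus, `map_add_right_eq_self`,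
fed into the general skew-product shear lemma `Kinetic.measurePreserving_shear`; GST 2013 §2.1,
the free-transport semigroup). [folklore] -/
theorem measurePreserving_torusShear {c : EuclideanSpace ℝ d → UnitAddTorus d}
    (hc : Measurable c) :
    MeasurePreserving (fun z : UnitAddTorus d × EuclideanSpace ℝ d => (z.1 + c z.2, z.2))
      ((volume : Measure (UnitAddTorus d)).prod (volume : Measure (EuclideanSpace ℝ d)))
      ((volume : Measure (UnitAddTorus d)).prod (volume : Measure (EuclideanSpace ℝ d))) :=
  measurePreserving_shear (μ := (volume : Measure (UnitAddTorus d)))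
    (ν := (volume : Measure (EuclideanSpace ℝ d))) (fun v x => x + c v)
    (measurable_snd.add (hc.comp measurable_fst)) fun v => map_add_right_eq_self volume (c v)

/-- Change of variables along free transport in integrals over `T^d × ℝ^d`. [folklore] -/
theorem integral_comp_shear {c : EuclideanSpace ℝ d → UnitAddTorus d} (hc : Measurable c)
    (F : UnitAddTorus d × EuclideanSpace ℝ d → ℝ) :
    ∫ z, F (z.1 + c z.2, z.2)
        ∂((volume : Measure (UnitAddTorus d)).prod (volume : Measure (EuclideanSpace ℝ d))) =
      ∫ z, F z ∂((volume : Measure (UnitAddTorus d)).prod (volume : Measure (EuclideanSpace ℝ d))) := by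
  obtain ⟨e, he⟩ := exists_measurableEquiv_shear hc
  have hfun : (fun z : UnitAddTorus d × EuclideanSpace ℝ d => (z.1 + c z.2, z.2)) = e :=
    funext fun z => (he z).symm
  have hpres : MeasurePreserving e
      ((volume : Measure (UnitAddTorus d)).prod (volume : Measure (EuclideanSpace ℝ d)))
      ((volume : Measure (UnitAddTorus d)).prod (volume : Measure (EuclideanSpace ℝ d))) := by
    rw [← hfun]
    exact measurePreserving_torusShear hc
  have h := hpres.integral_comp' F
  simpa only [he] using h

/-- Free transport preserves integrability on `T^d × ℝ^d`. [folklore] -/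
theorem integrable_comp_shear {c : EuclideanSpace ℝ d → UnitAddTorus d} (hc : Measurable c)
    {F : UnitAddTorus d × EuclideanSpace ℝ d → ℝ}
    (hF : Integrable F
      ((volume : Measure (UnitAddTorus d)).prod (volume : Measure (EuclideanSpace ℝ d)))) :
    Integrable (fun z : UnitAddTorus d × EuclideanSpace ℝ d => F (z.1 + c z.2, z.2))
      ((volume : Measure (UnitAddTorus d)).prod (volume : Measure (EuclideanSpace ℝ d))) := by
  obtain ⟨e, he⟩ := exists_measurableEquiv_shear hc
  have hfun : (fun z : UnitAddTorus d × EuclideanSpace ℝ d => (z.1 + c z.2, z.2)) = e :=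
    funext fun z => (he z).symm
  have hpres : MeasurePreserving e
      ((volume : Measure (UnitAddTorus d)).prod (volume : Measure (EuclideanSpace ℝ d)))
      ((volume : Measure (UnitAddTorus d)).prod (volume : Measure (EuclideanSpace ℝ d))) := by
    rw [← hfun]
    exact measurePreserving_torusShear hc
  have h := (hpres.integrable_comp_emb e.measurableEmbedding).2 hF
  refine h.congr (Eventually.of_forall fun z => ?_)
  simp only [Function.comp_apply, he]

variable {T : ℝ}
  {B : EuclideanSpace ℝ d × EuclideanSpace ℝ d → sphere (0 : EuclideanSpace ℝ d) 1 → ℝ}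
  {f : ℝ → UnitAddTorus d → EuclideanSpace ℝ d → ℝ}

/-- **Joint measurability of a continuous mild solution** (Carathéodory). The fact
`totalMass_eq` assumes no measurability of `f` in time; but along each characteristic Duhamel's
formula exhibits `t ↦ f♯(t, x, v) = f(0, x, v) + ∫₀ᵗ Q♯` as a primitive, hence continuous on
`[0, T]`, while each `f♯(t)` is continuous in `(x, v)`. So `f♯`, and then
`(t, x, v) ↦ f((t ∧ T) ∨ 0, x, v)` (time clamped to `[0, T]`), are jointly measurable
(`stronglyMeasurable_uncurry_of_continuous_of_stronglyMeasurable`). [folklore] -/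
theorem IsMildBoltzmannSolutionOn.measurable_uncurry_clamp
    (hf : IsMildBoltzmannSolutionOn T (Torus.geometry d) B f) (hT : 0 ≤ T)
    (hcont : ∀ t ∈ Icc 0 T, Continuous (Function.uncurry (f t))) :
    Measurable fun p : ℝ × UnitAddTorus d × EuclideanSpace ℝ d =>
      f (max 0 (min T p.1)) p.2.1 p.2.2 := by
  have hκm : ∀ τ, max 0 (min T τ) ∈ Icc 0 T := fun τ =>
    ⟨le_max_left _ _, max_le hT (min_le_left _ _)⟩
  have hκc : Continuous fun τ : ℝ => max 0 (min T τ) :=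
    continuous_const.max (continuous_const.min continuous_id)
  set F : ℝ → UnitAddTorus d × EuclideanSpace ℝ d → ℝ :=
    fun τ z => f (max 0 (min T τ)) (z.1 + FunctionSpaces.Torus.proj (max 0 (min T τ) • z.2)) z.2 with hF_def
  have hF : StronglyMeasurable (Function.uncurry F) := by
    refine stronglyMeasurable_uncurry_of_continuous_of_stronglyMeasurable
      (fun z => ?_) (fun τ => ?_)
    · obtain ⟨x, v⟩ := z
      have hq := hf.intervalIntegrable x v T ⟨hT, le_rfl⟩
      have hP : ContinuousOn (fun s => ∫ r in (0 : ℝ)..s,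
          alongFlow (Torus.geometry d) (collisionTerm B f) r x v) (uIcc 0 T) :=
        intervalIntegral.continuousOn_primitive_interval' hq left_mem_uIcc
      have hD : (fun τ => F τ (x, v)) = fun τ => f 0 x v + ∫ r in (0 : ℝ)..max 0 (min T τ),
          alongFlow (Torus.geometry d) (collisionTerm B f) r x v := by
        funext τ
        have h := hf.duhamel x v (max 0 (min T τ)) (hκm τ)
        rw [alongFlow, Torus.geometry_translate] at h
        exact h
      rw [hD]
      refine continuous_const.add (hP.comp_continuous hκc fun τ => ?_)
      rw [uIcc_of_le hT]
      exact hκm τ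
    · have hc : Continuous (Function.uncurry (f (max 0 (min T τ)))) := hcont _ (hκm τ)
      have hF' : F τ = Function.uncurry (f (max 0 (min T τ))) ∘
          fun z : UnitAddTorus d × EuclideanSpace ℝ d =>
            (z.1 + FunctionSpaces.Torus.proj (max 0 (min T τ) • z.2), z.2) := rfl
      rw [hF']
      refine (hc.comp ?_).stronglyMeasurable
      have := FunctionSpaces.Torus.continuous_proj (d := d)
      fun_prop
  have hrepr : (fun p : ℝ × UnitAddTorus d × EuclideanSpace ℝ d =>
      f (max 0 (min T p.1)) p.2.1 p.2.2) =
      Function.uncurry F ∘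
        fun p => (p.1, (p.2.1 - FunctionSpaces.Torus.proj (max 0 (min T p.1) • p.2.2), p.2.2)) := by
    funext p
    simp only [Function.comp_apply, Function.uncurry_apply_pair, hF_def, sub_add_cancel]
  rw [hrepr]
  refine hF.measurable.comp (Continuous.measurable ?_)
  have := FunctionSpaces.Torus.continuous_proj (d := d)
  fun_prop

/-- Conservation of mass with the joint measurability made explicit (the analytic core of
`totalMass_eq_holds`): integrate Duhamel's formula over `T^d × ℝ^d`, undo free transport by the
measure-preserving shear, exchange `dx dv` and `dτ`, and use `∫∫ Q_B(f(τ, x, ·)) dv dx = 0`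
(GST 2013 §2.2). [cite: GST2013, Part I Ch. 2 §2.2] -/
theorem IsMildBoltzmannSolutionOn.totalMass_eq_aux
    (hf : IsMildBoltzmannSolutionOn T (Torus.geometry d) B f) (hB : IsGradCutoffKernel B)
    {β : ℝ} (hβ : 0 < β) {M : ℝ}
    (hM : ∀ t ∈ Icc 0 T, ∀ x v, |f t x v| ≤ M * exp (-(β / 2) * ‖v‖ ^ 2))
    (hcont : ∀ t ∈ Icc 0 T, Continuous (Function.uncurry (f t)))
    (hmeas : Measurable fun p : ℝ × UnitAddTorus d × EuclideanSpace ℝ d =>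
      f (max 0 (min T p.1)) p.2.1 p.2.2)
    {t : ℝ} (ht : t ∈ Icc 0 T) :
    totalMass (f t) = totalMass (f 0) := by
  have hT : 0 ≤ T := ht.1.trans ht.2
  have h0 : (0 : ℝ) ∈ Icc 0 T := ⟨le_rfl, hT⟩
  have hκm : ∀ τ, max 0 (min T τ) ∈ Icc 0 T := fun τ =>
    ⟨le_max_left _ _, max_le hT (min_le_left _ _)⟩
  have hκ : ∀ τ ∈ Icc 0 T, max 0 (min T τ) = τ := fun τ hτ => by
    rw [min_eq_right hτ.2, max_eq_right hτ.1]
  set ψ : EuclideanSpace ℝ d → ℝ := fun u => (1 + ‖u‖) * exp (-(β / 2) * ‖u‖ ^ 2) with hψ_def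
  have hψ : Integrable ψ (volume : Measure (EuclideanSpace ℝ d)) :=
    integrable_one_add_norm_mul_exp hβ
  have he : Integrable (fun u : EuclideanSpace ℝ d => M * exp (-(β / 2) * ‖u‖ ^ 2))
      (volume : Measure (EuclideanSpace ℝ d)) :=
    (integrable_exp_neg_mul_sq_norm (by positivity)).const_mul M
  -- slices are measurable
  have hms : ∀ s ∈ Icc 0 T, Measurable (Function.uncurry (f s)) :=
    fun s hs => (hcont s hs).measurable
  -- (I1) integrability of the slices on `T^d × ℝ^d`, total mass as a product integral
  have hI1 : ∀ s ∈ Icc 0 T, Integrable (fun z : UnitAddTorus d × EuclideanSpace ℝ d => f s z.1 z.2)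
      ((volume : Measure (UnitAddTorus d)).prod (volume : Measure (EuclideanSpace ℝ d))) := by
    intro s hs
    refine (he.comp_snd (volume : Measure (UnitAddTorus d))).mono'
      (hcont s hs).aestronglyMeasurable (Eventually.of_forall fun z => ?_)
    rw [Real.norm_eq_abs]
    exact hM s hs z.1 z.2
  have hmass : ∀ s ∈ Icc 0 T, totalMass (f s) = ∫ z, f s z.1 z.2
      ∂((volume : Measure (UnitAddTorus d)).prod (volume : Measure (EuclideanSpace ℝ d))) :=
    fun s hs =>
      (integral_prod (fun z : UnitAddTorus d × EuclideanSpace ℝ d => f s z.1 z.2) (hI1 s hs)).symm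
  rw [hmass t ht, hmass 0 h0]
  -- the collision term: uniform bound, integrability and vanishing integral of each slice
  obtain ⟨C, hC⟩ := exists_abs_collisionOpWith_le hB hβ M
  have hQ : ∀ s ∈ Icc 0 T,
      Integrable (fun z : UnitAddTorus d × EuclideanSpace ℝ d => collisionTerm B f s z.1 z.2)
        ((volume : Measure (UnitAddTorus d)).prod (volume : Measure (EuclideanSpace ℝ d))) ∧
      ∫ z, collisionTerm B f s z.1 z.2
        ∂((volume : Measure (UnitAddTorus d)).prod (volume : Measure (EuclideanSpace ℝ d))) = 0 := by
    intro s hs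
    have hg' : Measurable (Function.uncurry
        fun z : UnitAddTorus d × EuclideanSpace ℝ d => f s z.1) :=
      (hms s hs).comp (measurable_fst.fst.prodMk measurable_snd)
    have hmQ : Measurable fun z : UnitAddTorus d × EuclideanSpace ℝ d =>
        collisionTerm B f s z.1 z.2 :=
      measurable_collisionOpWith_param hB.measurable hg' measurable_snd
    have hbd : ∀ z : UnitAddTorus d × EuclideanSpace ℝ d,
        |collisionTerm B f s z.1 z.2| ≤ C * ψ z.2 := fun z =>
      hC (f s z.1) ((hms s hs).comp measurable_prodMk_left) (hM s hs z.1) z.2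
    have hint : Integrable (fun z : UnitAddTorus d × EuclideanSpace ℝ d =>
        collisionTerm B f s z.1 z.2)
        ((volume : Measure (UnitAddTorus d)).prod (volume : Measure (EuclideanSpace ℝ d))) :=
      ((hψ.const_mul C).comp_snd (volume : Measure (UnitAddTorus d))).mono'
        hmQ.aestronglyMeasurable
        (Eventually.of_forall fun z => by rw [Real.norm_eq_abs]; exact hbd z)
    refine ⟨hint, ?_⟩
    rw [integral_prod _ hint]
    refine integral_eq_zero_of_ae (Eventually.of_forall fun y => ?_)
    have hgl := integrable_gain_loss hB hβ ((hms s hs).comp measurable_prodMk_left) (hM s hs y)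
    exact integral_collisionOpWith_eq_zero hB hgl.1 hgl.2
  -- Duhamel's formula, read at the foot `x = y - t v` of the characteristic through `(t, y, v)`;
  -- the time argument is clamped to `[0, T]` (no effect on `(0, t]`) to use `hmeas`
  set H : UnitAddTorus d × EuclideanSpace ℝ d → ℝ → ℝ := fun z τ =>
    collisionTerm B f (max 0 (min T τ)) (z.1 - FunctionSpaces.Torus.proj (t • z.2) + FunctionSpaces.Torus.proj (τ • z.2)) z.2
    with hH_def
  have hduh : ∀ z : UnitAddTorus d × EuclideanSpace ℝ d,
      f t z.1 z.2 = f 0 (z.1 - FunctionSpaces.Torus.proj (t • z.2)) z.2 + ∫ τ in Ioc 0 t, H z τ := by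
    intro z
    have h := hf.duhamel (z.1 - FunctionSpaces.Torus.proj (t • z.2)) z.2 t ht
    rw [intervalIntegral.integral_of_le ht.1, alongFlow, Torus.geometry_translate,
      sub_add_cancel] at h
    rw [h]
    congr 1
    refine setIntegral_congr_fun measurableSet_Ioc fun τ hτ => ?_
    simp only [hH_def, alongFlow, Torus.geometry_translate, hκ τ ⟨hτ.1.le, hτ.2.trans ht.2⟩]
  -- measurability and integrability of `H` on `(T^d × ℝ^d) × (0, t]`
  have hHm : Measurable (Function.uncurry H) := by
    have hsh : Measurable fun a : (UnitAddTorus d × EuclideanSpace ℝ d) × ℝ =>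
        a.1.1 - FunctionSpaces.Torus.proj (t • a.1.2) + FunctionSpaces.Torus.proj (a.2 • a.1.2) := by
      refine Continuous.measurable ?_
      have := FunctionSpaces.Torus.continuous_proj (d := d)
      fun_prop
    have hg' : Measurable (Function.uncurry
        fun a : (UnitAddTorus d × EuclideanSpace ℝ d) × ℝ =>
          f (max 0 (min T a.2)) (a.1.1 - FunctionSpaces.Torus.proj (t • a.1.2) + FunctionSpaces.Torus.proj (a.2 • a.1.2))) :=
      hmeas.comp (measurable_fst.snd.prodMk ((hsh.comp measurable_fst).prodMk measurable_snd))
    exact measurable_collisionOpWith_param hB.measurable hg' measurable_fst.snd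
  have hHb : ∀ z τ, |H z τ| ≤ C * ψ z.2 := fun z τ =>
    hC (f (max 0 (min T τ)) (z.1 - FunctionSpaces.Torus.proj (t • z.2) + FunctionSpaces.Torus.proj (τ • z.2)))
      ((hms _ (hκm τ)).comp measurable_prodMk_left) (hM _ (hκm τ) _) z.2
  have hHi : Integrable (Function.uncurry H)
      (((volume : Measure (UnitAddTorus d)).prod (volume : Measure (EuclideanSpace ℝ d))).prod
        (volume.restrict (Ioc 0 t))) :=
    (((hψ.const_mul C).comp_snd (volume : Measure (UnitAddTorus d))).comp_fst
      (volume.restrict (Ioc 0 t))).mono' hHm.aestronglyMeasurable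
      (Eventually.of_forall fun a => by rw [Real.norm_eq_abs]; exact hHb a.1 a.2)
  -- the free-transport term
  have hcneg : Measurable fun v : EuclideanSpace ℝ d => -FunctionSpaces.Torus.proj (t • v) := by
    refine Continuous.measurable ?_
    have := FunctionSpaces.Torus.continuous_proj (d := d)
    fun_prop
  have hA : ∫ z, f 0 (z.1 - FunctionSpaces.Torus.proj (t • z.2)) z.2
      ∂((volume : Measure (UnitAddTorus d)).prod (volume : Measure (EuclideanSpace ℝ d))) =
      ∫ z, f 0 z.1 z.2
      ∂((volume : Measure (UnitAddTorus d)).prod (volume : Measure (EuclideanSpace ℝ d))) := by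
    have h := integral_comp_shear hcneg
      (fun z : UnitAddTorus d × EuclideanSpace ℝ d => f 0 z.1 z.2)
    simpa only [← sub_eq_add_neg] using h
  have hAi : Integrable (fun z : UnitAddTorus d × EuclideanSpace ℝ d =>
      f 0 (z.1 - FunctionSpaces.Torus.proj (t • z.2)) z.2)
      ((volume : Measure (UnitAddTorus d)).prod (volume : Measure (EuclideanSpace ℝ d))) := by
    have h := integrable_comp_shear hcneg (hI1 0 h0)
    simpa only [← sub_eq_add_neg] using h
  -- the collision term integrates to zero
  have hRi : Integrable (fun z : UnitAddTorus d × EuclideanSpace ℝ d => ∫ τ in Ioc 0 t, H z τ)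
      ((volume : Measure (UnitAddTorus d)).prod (volume : Measure (EuclideanSpace ℝ d))) :=
    hHi.integral_prod_left
  have hzero : ∀ τ ∈ Ioc 0 t, ∫ z, H z τ
      ∂((volume : Measure (UnitAddTorus d)).prod (volume : Measure (EuclideanSpace ℝ d))) = 0 := by
    intro τ hτ
    have hτT : τ ∈ Icc 0 T := ⟨hτ.1.le, hτ.2.trans ht.2⟩
    have hc : Measurable fun v : EuclideanSpace ℝ d =>
        -FunctionSpaces.Torus.proj (t • v) + FunctionSpaces.Torus.proj (τ • v) := by
      refine Continuous.measurable ?_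
      have := FunctionSpaces.Torus.continuous_proj (d := d)
      fun_prop
    have h := integral_comp_shear hc
      (fun z : UnitAddTorus d × EuclideanSpace ℝ d => collisionTerm B f τ z.1 z.2)
    rw [(hQ τ hτT).2] at h
    rw [← h]
    refine integral_congr_ae (Eventually.of_forall fun z => ?_)
    simp only [hH_def, hκ τ hτT, ← add_assoc, sub_eq_add_neg]
  have hR : ∫ z, (∫ τ in Ioc 0 t, H z τ)
      ∂((volume : Measure (UnitAddTorus d)).prod (volume : Measure (EuclideanSpace ℝ d))) = 0 := by
    rw [integral_integral_swap hHi]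
    calc ∫ τ in Ioc 0 t, ∫ z, H z τ
          ∂((volume : Measure (UnitAddTorus d)).prod (volume : Measure (EuclideanSpace ℝ d)))
        = ∫ τ in Ioc 0 t, (0 : ℝ) :=
          setIntegral_congr_fun measurableSet_Ioc fun τ hτ => hzero τ hτ
      _ = 0 := by simp
  -- assemble
  calc ∫ z, f t z.1 z.2
        ∂((volume : Measure (UnitAddTorus d)).prod (volume : Measure (EuclideanSpace ℝ d)))
      = ∫ z, (f 0 (z.1 - FunctionSpaces.Torus.proj (t • z.2)) z.2 + ∫ τ in Ioc 0 t, H z τ)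
          ∂((volume : Measure (UnitAddTorus d)).prod (volume : Measure (EuclideanSpace ℝ d))) :=
        integral_congr_ae (Eventually.of_forall hduh)
    _ = ∫ z, f 0 (z.1 - FunctionSpaces.Torus.proj (t • z.2)) z.2
          ∂((volume : Measure (UnitAddTorus d)).prod (volume : Measure (EuclideanSpace ℝ d))) +
        ∫ z, (∫ τ in Ioc 0 t, H z τ)
          ∂((volume : Measure (UnitAddTorus d)).prod (volume : Measure (EuclideanSpace ℝ d))) :=
        integral_add hAi hRi
    _ = ∫ z, f 0 z.1 z.2
          ∂((volume : Measure (UnitAddTorus d)).prod (volume : Measure (EuclideanSpace ℝ d))) := by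
        rw [hA, hR, add_zero]

/-- **Conservation of mass for mild solutions on the torus** (discharge of
`IsMildBoltzmannSolutionOn.totalMass_eq`; Gallagher–Saint-Raymond–Texier 2013, Part I Ch. 2,
§2.1 (2.1.1) and §2.2: `∫ Q(f,f) φ dv = 0` for the collision invariant `φ ≡ 1` and the local
conservation law `∂ₜ ∫ f dv + ∇ₓ · ∫ f v dv = 0`, integrated over `T^d`; CIP 1994 §3.1). The
Gaussian weighted sup bound is turned into the pointwise bound `|f| ≤ C e^{-β|v|²/2}`, joint
measurability comes from `measurable_uncurry_clamp`, and `totalMass_eq_aux` concludes.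
[cite: GST2013, Part I Ch. 2 §2.1–2.2] -/
theorem IsMildBoltzmannSolutionOn.totalMass_eq_holds :
    IsMildBoltzmannSolutionOn.totalMass_eq (d := d) (T := T) (B := B) := by
  intro f hf hB β hβ hL hcont t ht
  have hT : 0 ≤ T := ht.1.trans ht.2
  obtain ⟨Cₑ, hCₑ, hLe⟩ := hL
  have hM : ∀ s ∈ Icc 0 T, ∀ x v, |f s x v| ≤ Cₑ.toReal * exp (-(β / 2) * ‖v‖ ^ 2) := by
    intro s hs x v
    have h1 := (enorm_le_eGaussSupNorm β (f s) x v).trans (hLe s hs)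
    have h2 : exp (β / 2 * ‖v‖ ^ 2) * |f s x v| ≤ Cₑ.toReal := by
      rw [← ENNReal.ofReal_le_iff_le_toReal hCₑ.ne, ENNReal.ofReal_mul (exp_pos _).le,
        ← Real.enorm_eq_ofReal_abs]
      exact h1
    rw [show -(β / 2) * ‖v‖ ^ 2 = -(β / 2 * ‖v‖ ^ 2) by ring, Real.exp_neg, ← div_eq_mul_inv,
      le_div_iff₀ (exp_pos _), mul_comm]
    exact h2
  exact hf.totalMass_eq_aux hB hβ hM hcont (hf.measurable_uncurry_clamp hT hcont) ht

end Torus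

/-! ## Classical solutions are renormalised solutions (DiPerna–Lions 1989, p. 322) -/

section ClassicalIsRenormalisedProof

variable {E : Type*} [NormedAddCommGroup E] [InnerProductSpace ℝ E] [FiniteDimensional ℝ E]
  [MeasurableSpace E] [BorelSpace E]

/-- Slices of a compactly supported function along a section `ι` of a continuous map `proj`
(`proj ∘ ι = id`) are compactly supported: `support (g ∘ ι) ⊆ proj '' tsupport g`. [folklore] -/
theorem hasCompactSupport_comp_section {α β M : Type*} [TopologicalSpace α]
    [TopologicalSpace β] [R1Space β] [Zero M] {g : α → M} (hg : HasCompactSupport g)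
    {ι : β → α} {proj : α → β} (hproj : Continuous proj) (h : ∀ b, proj (ι b) = b) :
    HasCompactSupport (g ∘ ι) := by
  refine HasCompactSupport.intro (hg.image hproj) fun b hb => ?_
  by_contra hne
  exact hb ⟨ι b, subset_tsupport _ (Function.mem_support.2 hne), h b⟩

/-- Discharge of `IsClassicalBoltzmannSolutionOn.isRenormalisedSolution` (DiPerna–Lions 1989,
p. 322, (7)–(8): "if `f` is a smooth nonnegative solution of (1) then ... (8) holds", here with
`β(f) = log (1 + f)`; restated as Lemma 5.3.4 (ii), p. 144 of Cercignani–Illner–Pulvirenti 1994).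
Proof (folklore calculus, no collision-kernel hypothesis is needed). The non-differential clauses
are the hypotheses (`hmass`, `hcont`) or follow from continuity of `f` on `[0,∞) × E × E`
(measurability; `Q^±(f,f)/(1+f) = Q^± · (1+f)⁻¹` is locally integrable on the OPEN set
`(0,∞) × E × E` as a locally integrable function times the continuous function `(1+f)⁻¹`,
`LocallyIntegrableOn.mul_continuousOn`). For the distributional identity put
`Ψ := log (1 + f) φ` for a kinetic test function `φ`: since `φ` vanishes near `{t ≤ 0}` and `f` is
`C¹` with `1 + f > 0` on `(0,∞) × E × E`, `Ψ ∈ C¹_c(ℝ × E × E)`. By the chain and product rules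
and the Boltzmann equation (`derivWithin (Ici 0) = deriv` at `t > 0`), the integrand equals
`∂ₜΨ + v·∇ₓΨ` pointwise (both sides vanish for `t ≤ 0`). Both partial derivatives are continuous
with compact support, so Fubini applies: `∫_E v·∇ₓΨ dx = 0` for each `(t, v)` (integration by
parts against the constant `1`, `integral_mul_fderiv_eq_neg_fderiv_mul_of_integrable`) and
`∫_ℝ ∂ₜΨ dt = 0` for each `(x, v)` (`integral_eq_zero_of_hasDerivAt_of_integrable`).
[cite: DiPernaLions1989, p. 322 (7)–(8)] -/
theorem IsClassicalBoltzmannSolutionOn.isRenormalisedSolution_holds :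
    IsClassicalBoltzmannSolutionOn.isRenormalisedSolution (E := E) := by
  intro B f hf hmass hgain hloss hcont
  -- notation: time set, open interior domain, uncurried density
  set S : Set ℝ := Ici 0
  set U : Set (ℝ × E × E) := Ioi 0 ×ˢ univ
  set F : ℝ × E × E → ℝ := fun z => f z.1 z.2.1 z.2.2
  have hF : ContDiffOn ℝ 1 F (S ×ˢ univ) := hf.contDiffOn
  have hFc : ContinuousOn F (S ×ˢ univ) := hF.continuousOn
  have hU_open : IsOpen U := isOpen_Ioi.prod isOpen_univ
  have hU_meas : MeasurableSet U := measurableSet_Ioi.prod MeasurableSet.univ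
  have hUS : U ⊆ S ×ˢ univ := prod_mono Ioi_subset_Ici_self Subset.rfl
  have hU_nhds : ∀ z ∈ U, S ×ˢ univ ∈ 𝓝 z := fun z hz =>
    mem_of_superset (hU_open.mem_nhds hz) hUS
  have hpos : ∀ t ≥ (0 : ℝ), ∀ x v, 0 < 1 + f t x v := fun t ht x v => by
    linarith [hf.nonneg t ht x v]
  have hinv : ContinuousOn (fun z => (1 + F z)⁻¹) U :=
    (continuousOn_const.add (hFc.mono hUS)).inv₀ fun z hz =>
      (hpos z.1 (le_of_lt hz.1) z.2.1 z.2.2).ne'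
  refine ⟨fun t ht x v => hf.nonneg t ht x v, fun t ht => ?_, ?_, hmass, ?_, ?_, ?_, hcont⟩
  · -- slices `f(t)` are continuous, hence measurable
    exact (hFc.comp_continuous (f := fun z : E × E => ((t, z) : ℝ × E × E)) (by fun_prop)
      fun z => mk_mem_prod ht (mem_univ _)).aestronglyMeasurable
  · -- `f` is continuous on `(0, ∞) × E × E`
    exact (hFc.mono hUS).aestronglyMeasurable hU_meas
  · -- `Q⁺(f,f)/(1+f)`: locally integrable times continuous on the open set `U`
    simpa [div_eq_mul_inv] using hgain.mul_continuousOn hinv hU_open.isLocallyClosed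
  · simpa [div_eq_mul_inv] using hloss.mul_continuousOn hinv hU_open.isLocallyClosed
  -- the renormalised equation in `𝒟'((0, ∞) × E × E)`
  intro φ hφ
  obtain ⟨hΦ, hΦsupp, hΦU⟩ := hφ
  set Φ : ℝ × E × E → ℝ := fun z => φ z.1 z.2.1 z.2.2
  have hΦ1 : ContDiff ℝ 1 Φ := hΦ.of_le (by exact_mod_cast le_top)
  -- `Φ` vanishes near every point with `t ≤ 0`
  have hΦ0 : ∀ z : ℝ × E × E, z.1 ≤ 0 → Φ =ᶠ[𝓝 z] 0 := fun z hz =>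
    notMem_tsupport_iff_eventuallyEq.1 fun h => not_lt.2 hz (hΦU h).1
  -- `Ψ = log (1 + f) φ` is `C¹` with compact support on the whole space
  set Ψ : ℝ × E × E → ℝ := fun z => log (1 + F z) * Φ z with hΨ_def
  have hΨ0 : ∀ z : ℝ × E × E, z.1 ≤ 0 → Ψ =ᶠ[𝓝 z] fun _ => 0 := fun z hz =>
    (hΦ0 z hz).mono fun w hw => by simp only [hΨ_def, hw, Pi.zero_apply, mul_zero]
  have hΨ : ContDiff ℝ 1 Ψ := by
    refine contDiff_iff_contDiffAt.2 fun z => ?_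
    rcases le_or_gt z.1 0 with hz | hz
    · exact contDiffAt_const.congr_of_eventuallyEq (hΨ0 z hz)
    · have hFz : ContDiffAt ℝ 1 F z := hF.contDiffAt (hU_nhds z ⟨hz, mem_univ _⟩)
      exact ((contDiffAt_const.add hFz).log (hpos z.1 hz.le z.2.1 z.2.2).ne').mul hΦ1.contDiffAt
  have hΨsupp : HasCompactSupport Ψ := hΦsupp.mul_left
  have hΨcont : Continuous Ψ := hΨ.continuous
  have hΨd : Differentiable ℝ Ψ := hΨ.differentiable one_ne_zero
  have hΨ'c : Continuous (fderiv ℝ Ψ) := hΨ.continuous_fderiv one_ne_zero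
  have hΨ'supp : HasCompactSupport (fderiv ℝ Ψ) := hΨsupp.fderiv (𝕜 := ℝ)
  have hfd0 : ∀ z : ℝ × E × E, z.1 ≤ 0 → fderiv ℝ Ψ z = 0 := fun z hz => by
    rw [(hΨ0 z hz).fderiv_eq (𝕜 := ℝ)]
    simp
  -- `A = ∂ₜΨ`, `D = v·∇ₓΨ`
  set A : ℝ × E × E → ℝ := fun z => fderiv ℝ Ψ z ((1 : ℝ), (0 : E × E)) with hA_def
  set D : ℝ × E × E → ℝ := fun z => fderiv ℝ Ψ z ((0 : ℝ), z.2.2, (0 : E)) with hD_def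
  have hAc : Continuous A := hΨ'c.clm_apply continuous_const
  have hDc : Continuous D := hΨ'c.clm_apply (by fun_prop)
  have hAsupp : HasCompactSupport A := hΨsupp.fderiv_apply (𝕜 := ℝ) ((1 : ℝ), (0 : E × E))
  have hDsupp : HasCompactSupport D := hΨ'supp.mono fun z hz h0 => hz (by
    simp only [hD_def, h0, zero_apply])
  have hA0 : ∀ z : ℝ × E × E, z.1 ≤ 0 → A z = 0 := fun z hz => by
    simp only [hA_def, hfd0 z hz, zero_apply]
  -- embeddings of the coordinate lines
  have hι1 : ∀ (t : ℝ) (p : E × E),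
      HasDerivAt (fun s : ℝ => ((s, p) : ℝ × E × E)) ((1 : ℝ), (0 : E × E)) t := fun t p =>
    (hasDerivAt_id' t).prodMk (hasDerivAt_const t p)
  have hι2 : ∀ (t : ℝ) (x v : E), HasFDerivAt (fun y : E => ((t, y, v) : ℝ × E × E))
      ((ContinuousLinearMap.inr ℝ ℝ (E × E)).comp (ContinuousLinearMap.inl ℝ E E)) x :=
    fun t x v => (hasFDerivAt_prodMk_right t (x, v)).comp x (hasFDerivAt_prodMk_left x v)
  -- chain rule along the coordinate lines for `Ψ`
  have hA_deriv : ∀ (t : ℝ) (p : E × E), HasDerivAt (fun s => Ψ (s, p)) (A (t, p)) t := by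
    intro t p
    have h := (hΨd (t, p)).hasFDerivAt.comp_hasDerivAt t (hι1 t p)
    exact h
  have hD_deriv : ∀ (t : ℝ) (x v : E), HasFDerivAt (fun y => Ψ (t, y, v))
      ((fderiv ℝ Ψ (t, x, v)).comp ((ContinuousLinearMap.inr ℝ ℝ (E × E)).comp
        (ContinuousLinearMap.inl ℝ E E))) x := by
    intro t x v
    have h := (hΨd (t, x, v)).hasFDerivAt.comp x (hι2 t x v)
    exact h
  have hD_eq : ∀ (t : ℝ) (x v : E), fderiv ℝ (fun y => Ψ (t, y, v)) x v = D (t, x, v) := by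
    intro t x v
    rw [(hD_deriv t x v).fderiv]
    simp [hD_def]
  -- the pointwise identity: integrand = `∂ₜΨ + v·∇ₓΨ`
  have hGeq : ∀ (t : ℝ) (x v : E), log (1 + f t x v) *
      (deriv (fun s => φ s x v) t + fderiv ℝ (fun y => φ t y v) x v) +
      renormalisedRHS B f t x v * φ t x v = A (t, x, v) + D (t, x, v) := by
    intro t x v
    rcases le_or_gt t 0 with ht | ht
    · -- both sides vanish: `φ` is zero near `(t, x, v)`
      have hz0 : Φ =ᶠ[𝓝 (t, x, v)] 0 := hΦ0 (t, x, v) ht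
      have hc1 : Continuous fun s : ℝ => ((s, x, v) : ℝ × E × E) := by fun_prop
      have hc2 : Continuous fun y : E => ((t, y, v) : ℝ × E × E) := by fun_prop
      have h1' : (fun s => φ s x v) =ᶠ[𝓝 t] fun _ => (0 : ℝ) := hz0.comp_tendsto (hc1.tendsto t)
      have h2' : (fun y => φ t y v) =ᶠ[𝓝 x] fun _ => (0 : ℝ) := hz0.comp_tendsto (hc2.tendsto x)
      have h1 : deriv (fun s => φ s x v) t = 0 := by rw [h1'.deriv_eq]; simp
      have h2 : fderiv ℝ (fun y => φ t y v) x = 0 := by rw [h2'.fderiv_eq]; simp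
      have h3 : φ t x v = 0 := hz0.eq_of_nhds
      have hD0 : D (t, x, v) = 0 := by
        simp only [hD_def, hfd0 (t, x, v) ht, zero_apply]
      rw [h1, h2, h3, hA0 (t, x, v) ht, hD0]
      simp
    · -- `t > 0`: chain and product rules, and the Boltzmann equation
      have hzU : ((t, x, v) : ℝ × E × E) ∈ U := ⟨ht, mem_univ _⟩
      have hFd : DifferentiableAt ℝ F (t, x, v) :=
        (hF.contDiffAt (hU_nhds _ hzU)).differentiableAt one_ne_zero
      have hΦd : DifferentiableAt ℝ Φ (t, x, v) := (hΦ1.differentiable one_ne_zero) _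
      have hf1 : HasDerivAt (fun s => f s x v) (fderiv ℝ F (t, x, v) ((1 : ℝ), (0 : E × E))) t := by
        have h := hFd.hasFDerivAt.comp_hasDerivAt t (hι1 t (x, v))
        exact h
      have hf2 : HasFDerivAt (fun y => f t y v) (fderiv ℝ (fun y => f t y v) x) x := by
        have h := (hFd.hasFDerivAt.comp x (hι2 t x v)).differentiableAt
        exact h.hasFDerivAt
      have hφ1 : HasDerivAt (fun s => φ s x v) (deriv (fun s => φ s x v) t) t := by
        have h := (hΦd.hasFDerivAt.comp_hasDerivAt t (hι1 t (x, v))).differentiableAt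
        exact h.hasDerivAt
      have hφ2 : HasFDerivAt (fun y => φ t y v) (fderiv ℝ (fun y => φ t y v) x) x := by
        have h := (hΦd.hasFDerivAt.comp x (hι2 t x v)).differentiableAt
        exact h.hasFDerivAt
      have hne : 1 + f t x v ≠ 0 := (hpos t ht.le x v).ne'
      -- slices of `Ψ`
      have hψ1 : HasDerivAt (fun s => Ψ (s, x, v))
          (fderiv ℝ F (t, x, v) ((1 : ℝ), (0 : E × E)) / (1 + f t x v) * φ t x v +
            log (1 + f t x v) * deriv (fun s => φ s x v) t) t :=
        ((hf1.const_add 1).log hne).mul hφ1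
      have hψ2 : HasFDerivAt (fun y => Ψ (t, y, v))
          (log (1 + f t x v) • fderiv ℝ (fun y => φ t y v) x +
            φ t x v • ((1 + f t x v)⁻¹ • fderiv ℝ (fun y => f t y v) x)) x :=
        ((hf2.const_add 1).log hne).mul hφ2
      have hA1 : A (t, x, v) = fderiv ℝ F (t, x, v) ((1 : ℝ), (0 : E × E)) / (1 + f t x v) *
          φ t x v + log (1 + f t x v) * deriv (fun s => φ s x v) t :=
        (hA_deriv t (x, v)).unique hψ1
      have hD1 : D (t, x, v) = log (1 + f t x v) * fderiv ℝ (fun y => φ t y v) x v +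
          φ t x v * ((1 + f t x v)⁻¹ * fderiv ℝ (fun y => f t y v) x v) := by
        rw [← hD_eq t x v, hψ2.fderiv]
        simp [smul_eq_mul]
      -- the Boltzmann equation at `(t, x, v)`; `derivWithin (Ici 0) = deriv` at `t > 0`
      have hB := hf.boltzmann t ht.le x v
      rw [derivWithin_of_mem_nhds (Ici_mem_nhds ht), hf1.deriv] at hB
      rw [hA1, hD1, renormalisedRHS, ← hB]
      field_simp
      ring
  -- integrability of the slices of `A`, `D`, `Ψ`
  have hAi : Integrable A (volume.prod (volume.prod volume)) :=
    hAc.integrable_of_hasCompactSupport hAsupp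
  have hAt : ∀ p : E × E, Integrable (fun t => A (t, p)) := fun p =>
    (hAc.comp (by fun_prop)).integrable_of_hasCompactSupport
      (hasCompactSupport_comp_section hAsupp continuous_fst (ι := fun t => (t, p)) fun _ => rfl)
  have hΨt : ∀ p : E × E, Integrable (fun t => Ψ (t, p)) := fun p =>
    (hΨcont.comp (by fun_prop)).integrable_of_hasCompactSupport
      (hasCompactSupport_comp_section hΨsupp continuous_fst (ι := fun t => (t, p)) fun _ => rfl)
  have hAp : ∀ t : ℝ, Integrable (fun p : E × E => A (t, p)) (volume.prod volume) := fun t =>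
    (hAc.comp (by fun_prop)).integrable_of_hasCompactSupport
      (hasCompactSupport_comp_section hAsupp continuous_snd (ι := fun p => (t, p)) fun _ => rfl)
  have hDp : ∀ t : ℝ, Integrable (fun p : E × E => D (t, p)) (volume.prod volume) := fun t =>
    (hDc.comp (by fun_prop)).integrable_of_hasCompactSupport
      (hasCompactSupport_comp_section hDsupp continuous_snd (ι := fun p => (t, p)) fun _ => rfl)
  have hDx : ∀ (t : ℝ) (v : E), Integrable (fun x => D (t, x, v)) := fun t v =>
    (hDc.comp (by fun_prop)).integrable_of_hasCompactSupport
      (hasCompactSupport_comp_section hDsupp (continuous_snd.fst) (ι := fun x => (t, x, v))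
        fun _ => rfl)
  have hΨx : ∀ (t : ℝ) (v : E), Integrable (fun x => Ψ (t, x, v)) := fun t v =>
    (hΨcont.comp (by fun_prop)).integrable_of_hasCompactSupport
      (hasCompactSupport_comp_section hΨsupp (continuous_snd.fst) (ι := fun x => (t, x, v))
        fun _ => rfl)
  -- `∫_x v·∇ₓΨ dx = 0` (integration by parts against the constant `1`), hence `∫∫ D = 0`
  have hDint : ∀ t : ℝ, ∫ x, ∫ v, D (t, x, v) = (0 : ℝ) := by
    intro t
    rw [integral_integral_swap (hDp t)]
    refine integral_eq_zero_of_ae (Eventually.of_forall fun v => ?_)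
    have h := integral_mul_fderiv_eq_neg_fderiv_mul_of_integrable (μ := (volume : Measure E))
      (f := fun _ : E => (1 : ℝ)) (g := fun y => Ψ (t, y, v)) (v := v) (by simp)
      (by simpa [hD_eq] using hDx t v) (by simpa using hΨx t v)
      (fun _ _ => differentiableAt_const _) (fun y _ => (hD_deriv t y v).differentiableAt)
    simpa [hD_eq] using h
  -- `∫_t ∂ₜΨ dt = 0` (compact support in `t`)
  have hAint : ∀ p : E × E, ∫ t, A (t, p) = (0 : ℝ) := fun p =>
    integral_eq_zero_of_hasDerivAt_of_integrable (fun s => hA_deriv s p) (hAt p) (hΨt p)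
  -- assembly
  have hsplit : ∀ t : ℝ, ∫ x, ∫ v, (log (1 + f t x v) *
      (deriv (fun s => φ s x v) t + fderiv ℝ (fun y => φ t y v) x v) +
      renormalisedRHS B f t x v * φ t x v) = ∫ p : E × E, A (t, p) ∂(volume.prod volume) := by
    intro t
    simp only [hGeq]
    rw [← integral_prod (fun p : E × E => A (t, p) + D (t, p)) ((hAp t).add (hDp t)),
      integral_add (hAp t) (hDp t), integral_prod _ (hDp t), hDint t, add_zero]
  simp_rw [hsplit]
  rw [setIntegral_eq_integral_of_forall_compl_eq_zero fun t ht => ?_]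
  · rw [integral_integral_swap hAi]
    exact integral_eq_zero_of_ae (Eventually.of_forall hAint)
  · have ht' : t ≤ 0 := not_lt.1 fun h => ht (mem_Ioi.2 h)
    have hA0' : ∀ p : E × E, A (t, p) = 0 := fun p => hA0 (t, p) ht'
    simp [hA0']

end ClassicalIsRenormalisedProof

end

end Literature.Analysis.FluidPDE
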